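import Literature.Computability.QuantumComplexity.ZXCalculusBlockSymmetry
import HarnessLib

/-!
# `ZX_{π/4}` modulo the calculus: the spider rules in usable form

Topic `Literature/Computability/QuantumComplexity`, continuing `ZXCalculusBlockSymmetry.lean` (layer
A6 of the formalisation of `JeandelPerdrixVilmart2018_completeness`). The fusion axiom (S1) of
`ZXDiagram.Rule` is ONE planar layout with a type cast in the middle; every derivation of JPV's
appendix uses it in several shapes. Here, modulo the calculus (`ZXClass`):

* spiders absorb identity casts (`ofEq_seq_Z`, `Z_seq_ofEq`), so that wire-count bookkeeping never
  blocks a fusion;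
* (S1) in four layouts: `fusion` (JPV's figure: first spider top-left, `j ≥ 1` joining wires, the
  re-bracketing as an explicit `ofEq`), `Z_par_seq_Z` (no by-passing inputs), `Z_seq_par_Z` (no
  by-passing outputs: second spider on the last outputs), `par_Z_seq_Z` (first spider on the last
  inputs), and the plain composite `Z_seq_Z : Z^{(n,j)}(a) ⨾ Z^{(j,m)}(b) = Z^{(n,m)}(a+b)`;
* (S2), (S3) and their flips: `Z_one_one`, `Z_zero_two`, `Z_two_zero`; splitting off phases
  (`Z_eq_Z_seq_phase`, `Z_eq_phase_seq_Z`), phase addition on a wire (`phase_seq_phase`);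
* commutativity of the two inputs / outputs of any spider with two of them (`swap_seq_Z`,
  `Z_seq_swap`), from the bent-wire axiom for `Z^{(2,1)}(0)` and fusion;
* everything in red as well, by the colour-swap symmetry (`X_seq_X`, `swap_seq_X`, …).

## References

* E. Jeandel, S. Perdrix, R. Vilmart, LICS 2018 (arXiv:1705.11151v2), Fig. 1 rules (S1)–(S3) and
  §2.2 [JeandelPerdrixVilmart2018].
* B. Coecke, R. Duncan, *Interacting quantum observables: categorical algebra and diagrammatics*,
  New J. Phys. 13 (2011), §6 (spider theorem) [CoeckeDuncan2011].
-/

noncomputable section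

namespace Literature.Computability.QuantumComplexity

open ZXDiagram ZXClass

variable {n m j k n' m' : ℕ}

namespace ZXDiagram

/-- A cast of a green spider is the green spider at the new arities. [folklore] -/
theorem Z_cast (a : ZMod 8) (hn : n = n') (hm : m = m') : (Z n m a).cast hn hm = Z n' m' a := by
  subst hn hm; rfl

/-- A cast of a red spider is the red spider at the new arities. [folklore] -/
theorem X_cast (a : ZMod 8) (hn : n = n') (hm : m = m') : (X n m a).cast hn hm = X n' m' a := by
  subst hn hm; rfl

/-- A cast of identities is identities. [folklore] -/
theorem wires_cast' (h h' : n = n') : (wires n).cast h h' = wires n' := by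
  subst h; rfl

end ZXDiagram

namespace ZXClass

/-! ### Spiders absorb identity casts -/

/-- A green spider absorbs a leading identity cast. [folklore] -/
@[simp] theorem ofEq_seq_Z (h : n' = n) (m : ℕ) (a : ZMod 8) :
    ofEq h ⨟ mk (Z n m a) = mk (Z n' m a) := by
  subst h; simp

/-- A green spider absorbs a trailing identity cast. [folklore] -/
@[simp] theorem Z_seq_ofEq (n : ℕ) (h : m = m') (a : ZMod 8) :
    mk (Z n m a) ⨟ ofEq h = mk (Z n m' a) := by
  subst h; simp

/-- A green spider absorbs a leading identity cast (with a trailing morphism). [folklore] -/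
@[simp] theorem ofEq_seq_Z_seq (h : n' = n) (m : ℕ) (a : ZMod 8) (A : ZXClass m k) :
    ofEq h ⨟ (mk (Z n m a) ⨟ A) = mk (Z n' m a) ⨟ A := by
  rw [← seq_assoc, ofEq_seq_Z]

/-- A green spider absorbs a trailing identity cast (with a trailing morphism). [folklore] -/
@[simp] theorem Z_seq_ofEq_seq (n : ℕ) (h : m = m') (a : ZMod 8) (A : ZXClass m' k) :
    mk (Z n m a) ⨟ (ofEq h ⨟ A) = mk (Z n m' a) ⨟ A := by
  rw [← seq_assoc, Z_seq_ofEq]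

/-- A red spider absorbs a leading identity cast. [folklore] -/
@[simp] theorem ofEq_seq_X (h : n' = n) (m : ℕ) (a : ZMod 8) :
    ofEq h ⨟ mk (X n m a) = mk (X n' m a) := by
  subst h; simp

/-- A red spider absorbs a trailing identity cast. [folklore] -/
@[simp] theorem X_seq_ofEq (n : ℕ) (h : m = m') (a : ZMod 8) :
    mk (X n m a) ⨟ ofEq h = mk (X n m' a) := by
  subst h; simp

/-- The class of a green spider only depends on its arities up to (propositional) equality.
[folklore] -/
theorem Z_congr (a : ZMod 8) (hn : n = n') (hm : m = m') :
    mk (Z n m a) = ofEq hn ⨟ mk (Z n' m' a) ⨟ ofEq hm.symm := by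
  subst hn hm; simp

/-! ### Fusion (S1) in its layouts -/

/-- **(S1), JPV's layout**: a spider `Z^{(n,m+j)}(a)` on the first wires whose last `j ≥ 1` outputs
feed a spider `Z^{(j+n',m')}(b)` that also takes the `n'` by-passing inputs; the re-bracketing
`(m + j) + n' = m + (j + n')` is an explicit identity cast. [cite: JeandelPerdrixVilmart2018, Fig. 1 (S1)] -/
theorem fusion (n m j m' n' : ℕ) (hj : 1 ≤ j) (a b : ZMod 8) :
    (mk (Z n (m + j) a) ⊠ mk (wires n')) ⨟ ofEq (Nat.add_assoc m j n') ⨟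
      (mk (wires m) ⊠ mk (Z (j + n') m' b)) = mk (Z (n + n') (m + m') (a + b)) := by
  have h := (Rule.fusion n m j m' n' hj a b).eq
  rw [mk_seq, mk_par, mk_cast, cast_eq_rfl, mk_par] at h
  simpa [seq_assoc] using h

/-- (S1) without by-passing inputs: `Z^{(n,m+j)}(a) ⨾ (𝕀ᵐ ⊗ Z^{(j,m')}(b)) = Z^{(n,m+m')}(a+b)`
(the second spider on the last `j ≥ 1` outputs). [cite: JeandelPerdrixVilmart2018, Fig. 1 (S1)] -/
theorem Z_seq_par_Z (n m j m' : ℕ) (hj : 1 ≤ j) (a b : ZMod 8) :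
    mk (Z n (m + j) a) ⨟ (mk (wires m) ⊠ mk (Z j m' b)) = mk (Z n (m + m') (a + b)) := by
  have h := fusion n m j m' 0 hj a b
  rw [par_empty] at h
  simpa using h

/-- (S1) without by-passing outputs of the first spider: `(Z^{(n,j)}(a) ⊗ 𝕀ⁿ') ⨾ Z^{(j+n',m')}(b) =
Z^{(n+n',m')}(a+b)` (the first spider on the first `n` inputs). [cite: JeandelPerdrixVilmart2018, Fig. 1 (S1)] -/
theorem Z_par_seq_Z (n j n' m' : ℕ) (hj : 1 ≤ j) (a b : ZMod 8) :
    (mk (Z n j a) ⊠ mk (wires n')) ⨟ mk (Z (j + n') m' b) = mk (Z (n + n') m' (a + b)) := by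
  have h := congrArg (· ⨟ ofEq (Nat.zero_add m')) (fusion n 0 j m' n' hj a b)
  simp only [seq_assoc, empty_par, cast_eq_ofEq, ofEq_seq_ofEq_seq, Z_seq_ofEq] at h
  rw [Z_congr (n := n) (m := 0 + j) a rfl (Nat.zero_add j)] at h
  simpa only [ofEq_rfl, id_seq, seq_par_wires, ofEq_par_wires, seq_assoc, ofEq_seq_ofEq_seq,
    ofEq_id] using h

/-- **(S1), plain composite**: `Z^{(n,j)}(a) ⨾ Z^{(j,m)}(b) = Z^{(n,m)}(a+b)` for `j ≥ 1` joining
wires. [cite: JeandelPerdrixVilmart2018, Fig. 1 (S1)] -/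
theorem Z_seq_Z (n j m : ℕ) (hj : 1 ≤ j) (a b : ZMod 8) :
    mk (Z n j a) ⨟ mk (Z j m b) = mk (Z n m (a + b)) := by
  have h := Z_par_seq_Z n j 0 m hj a b
  rw [par_empty] at h
  simpa using h

/-- (S1), the first spider on the LAST inputs: `(𝕀ᵐ ⊗ Z^{(m',j)}(b)) ⨾ Z^{(m+j,n)}(a) =
Z^{(m+m',n)}(a+b)` (the upside-down flip of `Z_seq_par_Z`). [cite: JeandelPerdrixVilmart2018, Fig. 1 (S1)] -/
theorem par_Z_seq_Z (m m' j n : ℕ) (hj : 1 ≤ j) (a b : ZMod 8) :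
    (mk (wires m) ⊠ mk (Z m' j b)) ⨟ mk (Z (m + j) n a) = mk (Z (m + m') n (a + b)) := by
  have h := congrArg transpose (Z_seq_par_Z n m j m' hj a b)
  simpa using h

/-- (S1), the second spider on the FIRST outputs with by-passing outputs: `Z^{(j+n',m')}(b)` fed by
… precisely the flip of `Z_par_seq_Z`: `Z^{(m',j+n')}(b) ⨾ (Z^{(j,n)}(a) ⊗ 𝕀ⁿ') = Z^{(m',n+n')}(a+b)`.
[cite: JeandelPerdrixVilmart2018, Fig. 1 (S1)] -/
theorem Z_seq_Z_par (m' j n' n : ℕ) (hj : 1 ≤ j) (a b : ZMod 8) :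
    mk (Z m' (j + n') b) ⨟ (mk (Z j n a) ⊠ mk (wires n')) = mk (Z m' (n + n') (a + b)) := by
  have h := congrArg transpose (Z_par_seq_Z n j n' m' hj a b)
  simpa using h

/-! ### (S2), (S3), phases -/

/-- **(S2)**: `Z^{(1,1)}(0) = 𝕀`. [cite: JeandelPerdrixVilmart2018, Fig. 1 (S2)] -/
@[simp] theorem Z_one_one : mk (Z 1 1 0) = mk (wires 1) := Rule.identity.eq

/-- **(S3)**: `Z^{(0,2)}(0)` is the cup. [cite: JeandelPerdrixVilmart2018, Fig. 1 (S3)] -/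
theorem Z_zero_two : mk (Z 0 2 0) = mk cup := Rule.cup_rule.eq

/-- (S3) upside down: `Z^{(2,0)}(0)` is the cap. [cite: JeandelPerdrixVilmart2018, Fig. 1 (S3)] -/
theorem Z_two_zero : mk (Z 2 0 0) = mk cap := (Rule.transpose Rule.cup_rule).eq

/-- Phases on a wire add up: `Z^{(1,1)}(a) ⨾ Z^{(1,1)}(b) = Z^{(1,1)}(a+b)`. [cite: JeandelPerdrixVilmart2018, Fig. 1 (S1)] -/
@[simp] theorem phase_seq_phase (a b : ZMod 8) :
    mk (Z 1 1 a) ⨟ mk (Z 1 1 b) = mk (Z 1 1 (a + b)) := Z_seq_Z 1 1 1 le_rfl a b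

/-- Splitting the phase off a spider with at least one output: `Z^{(n,m+1)}(a) =
Z^{(n,m+1)}(0) ⨾ (𝕀ᵐ ⊗ Z^{(1,1)}(a))`. [cite: JeandelPerdrixVilmart2018, Fig. 1 (S1)] -/
theorem Z_eq_Z_seq_phase (n m : ℕ) (a : ZMod 8) :
    mk (Z n (m + 1) a) = mk (Z n (m + 1) 0) ⨟ (mk (wires m) ⊠ mk (Z 1 1 a)) := by
  rw [Z_seq_par_Z n m 1 1 le_rfl, zero_add]

/-- Splitting the phase off a spider with at least one input: `Z^{(m+1,n)}(a) =
(𝕀ᵐ ⊗ Z^{(1,1)}(a)) ⨾ Z^{(m+1,n)}(0)`. [cite: JeandelPerdrixVilmart2018, Fig. 1 (S1)] -/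
theorem Z_eq_phase_seq_Z (m n : ℕ) (a : ZMod 8) :
    mk (Z (m + 1) n a) = (mk (wires m) ⊠ mk (Z 1 1 a)) ⨟ mk (Z (m + 1) n 0) := by
  rw [par_Z_seq_Z m 1 1 n le_rfl, zero_add]

/-- A spider factors through a single wire: `Z^{(n,m)}(a+b) = Z^{(n,1)}(a) ⨾ Z^{(1,m)}(b)`.
[cite: JeandelPerdrixVilmart2018, Fig. 1 (S1)] -/
theorem Z_eq_Z_seq_Z (n m : ℕ) (a b : ZMod 8) :
    mk (Z n m (a + b)) = mk (Z n 1 a) ⨟ mk (Z 1 m b) := (Z_seq_Z n 1 m le_rfl a b).symm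

/-! ### Two legs commute -/

/-- The two inputs of `Z^{(2,m)}(a)` commute. [cite: JeandelPerdrixVilmart2018, §2.2] -/
@[simp] theorem swap_seq_Z (m : ℕ) (a : ZMod 8) : mk swap ⨟ mk (Z 2 m a) = mk (Z 2 m a) := by
  rw [← zero_add a, Z_eq_Z_seq_Z 2 m 0 a, ← seq_assoc, swap_spider]

/-- The two outputs of `Z^{(n,2)}(a)` commute. [cite: JeandelPerdrixVilmart2018, §2.2] -/
@[simp] theorem Z_seq_swap (n : ℕ) (a : ZMod 8) : mk (Z n 2 a) ⨟ mk swap = mk (Z n 2 a) := by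
  have h := congrArg transpose (swap_seq_Z n a)
  simp only [transpose_seq, transpose_mk, transpose_swap, transpose_Z] at h
  exact h

/-! ### The same in red -/

/-- (S1) in red, plain composite. [cite: JeandelPerdrixVilmart2018, Fig. 1] -/
theorem X_seq_X (n j m : ℕ) (hj : 1 ≤ j) (a b : ZMod 8) :
    mk (X n j a) ⨟ mk (X j m b) = mk (X n m (a + b)) := by
  have h := congrArg colorSwap (Z_seq_Z n j m hj a b)
  simpa using h

/-- (S1) in red, second spider on the last outputs. [cite: JeandelPerdrixVilmart2018, Fig. 1] -/
theorem X_seq_par_X (n m j m' : ℕ) (hj : 1 ≤ j) (a b : ZMod 8) :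
    mk (X n (m + j) a) ⨟ (mk (wires m) ⊠ mk (X j m' b)) = mk (X n (m + m') (a + b)) := by
  have h := congrArg colorSwap (Z_seq_par_Z n m j m' hj a b)
  simpa using h

/-- (S1) in red, first spider on the first inputs. [cite: JeandelPerdrixVilmart2018, Fig. 1] -/
theorem X_par_seq_X (n j n' m' : ℕ) (hj : 1 ≤ j) (a b : ZMod 8) :
    (mk (X n j a) ⊠ mk (wires n')) ⨟ mk (X (j + n') m' b) = mk (X (n + n') m' (a + b)) := by
  have h := congrArg colorSwap (Z_par_seq_Z n j n' m' hj a b)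
  simpa using h

/-- (S1) in red, first spider on the last inputs. [cite: JeandelPerdrixVilmart2018, Fig. 1] -/
theorem par_X_seq_X (m m' j n : ℕ) (hj : 1 ≤ j) (a b : ZMod 8) :
    (mk (wires m) ⊠ mk (X m' j b)) ⨟ mk (X (m + j) n a) = mk (X (m + m') n (a + b)) := by
  have h := congrArg colorSwap (par_Z_seq_Z m m' j n hj a b)
  simpa using h

/-- (S2) in red: `X^{(1,1)}(0) = 𝕀`. [cite: JeandelPerdrixVilmart2018, Fig. 1] -/
@[simp] theorem X_one_one : mk (X 1 1 0) = mk (wires 1) := (Rule.colorSwap Rule.identity).eq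

/-- (S3) in red: `X^{(0,2)}(0)` is the cup. [cite: JeandelPerdrixVilmart2018, Fig. 1] -/
theorem X_zero_two : mk (X 0 2 0) = mk cup := (Rule.colorSwap Rule.cup_rule).eq

/-- (S3) in red, upside down: `X^{(2,0)}(0)` is the cap. [cite: JeandelPerdrixVilmart2018, Fig. 1] -/
theorem X_two_zero : mk (X 2 0 0) = mk cap := (Rule.colorSwap (Rule.transpose Rule.cup_rule)).eq

/-- Red phases on a wire add up. [cite: JeandelPerdrixVilmart2018, Fig. 1] -/
@[simp] theorem xphase_seq_xphase (a b : ZMod 8) :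
    mk (X 1 1 a) ⨟ mk (X 1 1 b) = mk (X 1 1 (a + b)) := X_seq_X 1 1 1 le_rfl a b

/-- The two inputs of `X^{(2,m)}(a)` commute. [cite: JeandelPerdrixVilmart2018, §2.2] -/
@[simp] theorem swap_seq_X (m : ℕ) (a : ZMod 8) : mk swap ⨟ mk (X 2 m a) = mk (X 2 m a) := by
  have h := congrArg colorSwap (swap_seq_Z m a)
  simp only [colorSwap_seq, colorSwap_mk, colorSwap_swap, colorSwap_Z] at h
  exact h

/-- The two outputs of `X^{(n,2)}(a)` commute. [cite: JeandelPerdrixVilmart2018, §2.2] -/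
@[simp] theorem X_seq_swap (n : ℕ) (a : ZMod 8) : mk (X n 2 a) ⨟ mk swap = mk (X n 2 a) := by
  have h := congrArg colorSwap (Z_seq_swap n a)
  simp only [colorSwap_seq, colorSwap_mk, colorSwap_swap, colorSwap_Z] at h
  exact h

end ZXClass

end Literature.Computability.QuantumComplexity
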